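import Mathlib
import Summits.PneNP.PneNP.Theses.AeaCutRectangles
import Summits.PneNP.PneNP.Theorems.AeaCutRectanglesDutyRectangles

/-!
# Stars and seams (crux-ideate round 2, seat 2, gen 5) — `stmt-PneNP-19727` `FoolingMeasure`

FRONTIER restricted-model rung (AEA / cut rectangles).  Nothing here bears on `P ≠ NP`.

First lemmas for the crux idea cards `star-extremality` (§§1,3) and `seam-covering-cliques` (§§2,4; §4 proves
`covers_of_validRect`, `captured_covClique` and the reduction `uniformRectBound_of_seamCliqueBound`):

* `relabel_union_not_colorable`, `star_rectangle_valid` (PROVED): if a permutation `τ` of the vertices fixes every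
  vertex outside the set `interior B G` of FULLY INTERIOR Bob vertices (all `G`-neighbours inside `B`), then
  `aliceSide B G ∪ τ • bobSide B G = τ • G` is not 3-colourable whenever `G` is not.  Hence for every support
  member `G` of an isomorphism-invariant measure and every cut `B` the STAR RECTANGLE
  `{aliceSide B G' : G'[B] = G[B], interior ⊇ interior B G} × {τ • G[B] : τ ∈ Sym(interior B G)}` is a cut rectangle
  inside NON-3-COL capturing `|interior|!·(Bob fibre)` relabelled members: the universal LOWER bound every X1
  measure must beat, and the conjectured extremiser (`StarExtremality`).
* `seamCol_eq_iff` (PROVED): the exact two-point law of a seam colouring of one ruler — two vertices get the same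
  colour iff their forward distance is `≡ 0 (mod 3)` with the seam off the forward arc, or `≡ 1 (mod 3)` with the
  seam ON the forward arc.  This is the SEAM-BLOCKING criterion used (and validated, 0 violations in ≈ 3·10⁴ pairs,
  kit j300244) to explain 95–98 % of all 3-colourable aligned hybrids of normal systems.
* typed targets: `StarExtremality`, `InteriorHalfDense`, `StarReduction`.
-/

set_option linter.dupNamespace false

namespace Summit.PneNP.PneNP.Cruxes.FoolingMeasure.IdeasR2g5s2

open Finset
open Fin.CommRing
open Summit.PneNP.PneNP.Theorems.AeaCutRectanglesDutyRectangles (aliceSide bobSide mem_aliceSide mem_bobSide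
  aliceSide_union_bobSide)

/-- 3-colourability of the graph spanned by an edge set over `Fin n` (as in the route file). -/
abbrev Col3 {n : ℕ} (G : Finset (Sym2 (Fin n))) : Prop :=
  (SimpleGraph.fromEdgeSet (G : Set (Sym2 (Fin n)))).Colorable 3

/-! ## 1. Star rectangles are valid -/

section star

variable {n : ℕ}

/-- If `τ` fixes every endpoint of every edge of `α`, a 3-colouring of `α ∪ τ•β` pulls back along `τ` to a
3-colouring of `α ∪ β`. -/
theorem relabel_union_colorable (α β : Finset (Sym2 (Fin n))) (τ : Equiv.Perm (Fin n))
    (hα : ∀ e ∈ α, ∀ v ∈ e, τ v = v) (hcol : Col3 (α ∪ β.image (Sym2.map τ))) : Col3 (α ∪ β) := by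
  obtain ⟨C⟩ := hcol
  refine ⟨SimpleGraph.Coloring.mk (fun v => C (τ v)) ?_⟩
  intro x y hadj
  rw [SimpleGraph.fromEdgeSet_adj] at hadj
  obtain ⟨hmem, hxy⟩ := hadj
  have hmem' : s(x, y) ∈ α ∪ β := hmem
  apply C.valid
  rw [SimpleGraph.fromEdgeSet_adj]
  refine ⟨?_, τ.injective.ne hxy⟩
  rcases Finset.mem_union.mp hmem' with h | h
  · have hx : τ x = x := hα _ h x (Sym2.mem_mk_left x y)
    have hy : τ y = y := hα _ h y (Sym2.mem_mk_right x y)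
    rw [hx, hy]
    exact Finset.mem_coe.mpr (Finset.mem_union_left _ h)
  · apply Finset.mem_coe.mpr
    apply Finset.mem_union_right
    exact Finset.mem_image.mpr ⟨s(x, y), h, by simp⟩

/-- Contrapositive form: relabelling Bob's side by a permutation fixing all of Alice's endpoints keeps the hybrid
non-3-colourable. -/
theorem relabel_union_not_colorable (α β : Finset (Sym2 (Fin n))) (τ : Equiv.Perm (Fin n))
    (hα : ∀ e ∈ α, ∀ v ∈ e, τ v = v) (h : ¬ Col3 (α ∪ β)) : ¬ Col3 (α ∪ β.image (Sym2.map τ)) :=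
  fun hc => h (relabel_union_colorable α β τ hα hc)

open Classical in
/-- the FULLY INTERIOR Bob vertices of `G` at the cut `B`: vertices of `B` all of whose `G`-neighbours lie in `B`
(for a `2t`-regular `G`: the vertices of degree `2t` in `bobSide B G`).  No edge of Alice's side touches them. -/
noncomputable def interior (B : Finset (Fin n)) (G : Finset (Sym2 (Fin n))) : Finset (Fin n) :=
  B.filter fun v => ∀ e ∈ G, v ∈ e → ∀ w ∈ e, w ∈ B

theorem aliceSide_avoids_interior (B : Finset (Fin n)) (G : Finset (Sym2 (Fin n))) :
    ∀ e ∈ aliceSide B G, ∀ v ∈ e, v ∉ interior B G := by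
  classical
  intro e he v hv hvD
  obtain ⟨heG, w, hw, hwB⟩ := mem_aliceSide.mp he
  exact hwB ((Finset.mem_filter.mp hvD).2 e heG hv w hw)

/-- **Star rectangles are cut rectangles inside NON-3-COL.**  For any non-3-colourable `G`, cut `B` and permutation
`τ` supported on the fully interior Bob vertices, Alice's side of `G` together with the RELABELLED Bob side `τ • G[B]`
is not 3-colourable (indeed it is `τ • G`).  Applied to every `G'` with the same Bob side as `G` (the Bob fibre) and
every `τ ∈ Sym(interior B G)`, this exhibits the star rectangle of the card. -/
theorem star_rectangle_valid (B : Finset (Fin n)) (G : Finset (Sym2 (Fin n))) (τ : Equiv.Perm (Fin n))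
    (hτ : ∀ v, v ∉ interior B G → τ v = v) (hG : ¬ Col3 G) :
    ¬ Col3 (aliceSide B G ∪ (bobSide B G).image (Sym2.map τ)) := by
  classical
  apply relabel_union_not_colorable
  · intro e he v hv
    exact hτ v (aliceSide_avoids_interior B G e he v hv)
  · rw [aliceSide_union_bobSide]; exact hG

/-- The row condition of the star: a second member `G'` with the SAME Bob side and at least the same interior has an
Alice side avoiding `interior B G`, so the same relabelled columns are compatible with it. -/
theorem star_rectangle_valid_row (B : Finset (Fin n)) (G G' : Finset (Sym2 (Fin n))) (τ : Equiv.Perm (Fin n))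
    (hτ : ∀ v, v ∉ interior B G → τ v = v) (hint : interior B G ⊆ interior B G')
    (hβ : bobSide B G' = bobSide B G) (hG' : ¬ Col3 G') :
    ¬ Col3 (aliceSide B G' ∪ (bobSide B G).image (Sym2.map τ)) := by
  classical
  rw [← hβ]
  apply star_rectangle_valid B G' τ _ hG'
  intro v hv
  exact hτ v (fun h => hv (hint h))

end star

/-! ## 2. The two-point law of a seam colouring (seam-blocking criterion) -/

section seam

variable {q : ℕ}

/-- value of a difference in `Fin (3q+1)`, by cases on the wrap. -/
theorem val_sub_cases (a b : Fin (3 * q + 1)) :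
    (a.val ≤ b.val ∧ (b - a).val = b.val - a.val) ∨ (b.val < a.val ∧ (b - a).val = 3 * q + 1 + b.val - a.val) := by
  by_cases h : a ≤ b
  · exact Or.inl ⟨Fin.le_def.1 h, Fin.coe_sub_iff_le.2 h⟩
  · have hlt : b < a := lt_of_not_ge h
    exact Or.inr ⟨Fin.lt_def.1 hlt, Fin.coe_sub_iff_lt.2 hlt⟩

/-- the seam colouring of one ruler `pos` (a position map) based at the vertex `v` (seam = the cycle edge leaving `v`):
colour of `w` = `(pos w − pos v − 1) mod 3`.  (Seat 2's `seamColour S k v`, one ruler at a time.) -/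
def seamCol (pos : Equiv.Perm (Fin (3 * q + 1))) (v w : Fin (3 * q + 1)) : Fin 3 :=
  ⟨(pos w - pos v - 1).val % 3, Nat.mod_lt _ (by norm_num)⟩

/-- **Two-point law.**  Under the seam colouring based at `v`, the vertices `u` and `w` receive the same colour iff
EITHER their forward distance `pos w − pos u` is `≡ 0 (mod 3)` and, walking forward from the seam, `u` is met no later
than `w`, OR the forward distance is `≡ 1 (mod 3)` and `w` is met strictly before `u` (the seam lies on the forward arc
from `u` to `w`).  For an aligned Bob edge (`pos w − pos u ≢ 0`) this is the seam-BLOCKING rule: the edge is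
monochromatic iff it straddles the seam with forward distance `≡ 1 (mod 3)`. -/
theorem seamCol_eq_iff (pos : Equiv.Perm (Fin (3 * q + 1))) (v u w : Fin (3 * q + 1)) :
    seamCol pos v u = seamCol pos v w ↔
      (((pos w - pos u).val % 3 = 0 ∧ (pos u - pos v - 1).val ≤ (pos w - pos v - 1).val) ∨
       ((pos w - pos u).val % 3 = 1 ∧ (pos w - pos v - 1).val < (pos u - pos v - 1).val)) := by
  have hval : (seamCol pos v u = seamCol pos v w) ↔
      (pos u - pos v - 1).val % 3 = (pos w - pos v - 1).val % 3 := by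
    simp [seamCol, Fin.ext_iff]
  have hwu : pos w - pos u = (pos w - pos v - 1) - (pos u - pos v - 1) := by ring
  rw [hval, hwu]
  generalize pos u - pos v - 1 = a
  generalize pos w - pos v - 1 = b
  have hA := a.isLt
  have hB := b.isLt
  rcases val_sub_cases a b with ⟨h1, e1⟩ | ⟨h1, e1⟩ <;> rw [e1] <;> omega

end seam

/-! ## 3. Typed targets of the card (normal-system universe, minimal mirror of the seat's definitions) -/

section targets

/-- `t` rulers on `n = 3q+1` vertices: `P k v` is the position of `v` along ruler `k`. -/
abbrev Rulers (q t : ℕ) := Fin t → Equiv.Perm (Fin (3 * q + 1))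

variable {q t : ℕ}

/-- successor of `v` along ruler `k`. -/
def succ (P : Rulers q t) (k : Fin t) (v : Fin (3 * q + 1)) : Fin (3 * q + 1) :=
  (P k).symm (P k v + 1)

/-- NORMALITY: every edge of cycle `k`, read along any other ruler `i`, jumps forward by `≡ 2 (mod 3)`. -/
def IsNormal (P : Rulers q t) : Prop :=
  ∀ i k : Fin t, i ≠ k → ∀ v, ((P i (succ P k v) - P i v).val) % 3 = 2

/-- the edge set: union of the `t` Hamiltonian cycles. -/
def edges (P : Rulers q t) : Finset (Sym2 (Fin (3 * q + 1))) :=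
  univ.biUnion fun k => univ.image fun v => s(v, succ P k v)

open Classical in
/-- the support of `μ_t`: labelled normal, non-3-colourable `t`-systems. -/
noncomputable def Supp (q t : ℕ) : Finset (Rulers q t) :=
  univ.filter fun P => IsNormal P ∧ ¬ Col3 (edges P)

open Classical in
/-- the Bob fibre of `β` at the cut `B`: support members whose edges inside `B` are exactly `β`. -/
noncomputable def bobFibre (q t : ℕ) (B : Finset (Fin (3 * q + 1))) (β : Finset (Sym2 (Fin (3 * q + 1)))) :
    Finset (Rulers q t) :=
  (Supp q t).filter fun P => bobSide B (edges P) = β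

/-- a cut rectangle over `B` inside NON-3-COL (X1's three hypotheses verbatim). -/
def ValidRect {n : ℕ} (B : Finset (Fin n)) (𝓐 𝓑 : Finset (Finset (Sym2 (Fin n)))) : Prop :=
  (∀ α ∈ 𝓐, ∀ e ∈ α, ¬ e.IsDiag ∧ ∃ v ∈ e, v ∉ B) ∧ (∀ β ∈ 𝓑, ∀ e ∈ β, ¬ e.IsDiag ∧ ∀ v ∈ e, v ∈ B) ∧
    ∀ α ∈ 𝓐, ∀ β ∈ 𝓑, ¬ Col3 (α ∪ β)

open Classical in
/-- members CAPTURED by the rectangle: both sides filed. (`μ_t(𝓐 ⊗ 𝓑) = |Captured| / |Supp|`.) -/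
noncomputable def Captured (q t : ℕ) (B : Finset (Fin (3 * q + 1)))
    (𝓐 𝓑 : Finset (Finset (Sym2 (Fin (3 * q + 1))))) : Finset (Rulers q t) :=
  (Supp q t).filter fun P => aliceSide B (edges P) ∈ 𝓐 ∧ bobSide B (edges P) ∈ 𝓑

/-- **STAR EXTREMALITY (the card's crux, replacing (Q) ∧ (E)).**  Up to a factor `2^{K n}`, no cut rectangle captures
more of `μ_t` than the best STAR `(Bob fibre of β) × Sym(interior)`: for every `q`, every cut `B` and every valid
rectangle, `|Captured| ≤ 2^{K n} · |bobFibre β| · |interior B G|!` for some support member `G` with `β = G[B]`.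
(The matching LOWER bound — stars are captured in full — is `star_rectangle_valid_row`.) -/
def StarExtremality (t : ℕ) : Prop :=
  ∃ K : ℕ, ∀ (q : ℕ) (B : Finset (Fin (3 * q + 1))) (𝓐 𝓑 : Finset (Finset (Sym2 (Fin (3 * q + 1))))),
    ValidRect B 𝓐 𝓑 → (Captured q t B 𝓐 𝓑).Nonempty →
      ∃ P ∈ Supp q t, ((Captured q t B 𝓐 𝓑).card : ℝ) ≤
        (2 : ℝ) ^ (K * (3 * q + 1)) * (bobFibre q t B (bobSide B (edges P))).card *
          Nat.factorial (interior B (edges P)).card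

/-- INTERIOR-CORRECTED half-density of one system: every near-half `B` spans at least `(1/2+ε)·n` edges AFTER
discounting one unit per fully interior vertex — the quantity `e(G[B]) − |interior|` that the star lower bound shows
is the true exponent (`μ_t(star) ≈ n^{|interior| − e(G[B])}`). -/
def InteriorHalfDense (ε δ : ℝ) (P : Rulers q t) : Prop :=
  ∀ B : Finset (Fin (3 * q + 1)),
    (1 / 2 - δ) * (3 * q + 1 : ℝ) ≤ B.card → (B.card : ℝ) ≤ (1 / 2 + δ) * (3 * q + 1 : ℝ) →
      (1 / 2 + ε) * (3 * q + 1 : ℝ) ≤ ((bobSide B (edges P)).card : ℝ) - (interior B (edges P)).card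

open Classical in
/-- abundance of interior-half-dense rigid normal systems at the labelled first-moment rate. -/
def StrongAbundanceIHD (t : ℕ) (ε δ : ℝ) : Prop :=
  ∃ κ q₀ : ℕ, ∀ q ≥ q₀, (Nat.factorial (3 * q + 1)) ^ t ≤
    2 ^ (κ * (3 * q + 1)) * ((Supp q t).filter fun P => InteriorHalfDense ε δ P).card

open Classical in
/-- the X1 rectangle clause for the uniform measure on the interior-half-dense part of the support, at every
near-balanced cut, eventually in `q` for each `C`. -/
noncomputable def UniformRectBound (t : ℕ) (ε δ : ℝ) : Prop :=
  ∀ C : ℕ, ∃ q₀ : ℕ, ∀ q ≥ q₀, ∀ (B : Finset (Fin (3 * q + 1))) (𝓐 𝓑 : Finset (Finset (Sym2 (Fin (3 * q + 1))))),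
    (1 / 2 - δ) * (3 * q + 1 : ℝ) ≤ B.card → (B.card : ℝ) ≤ (1 / 2 + δ) * (3 * q + 1 : ℝ) → ValidRect B 𝓐 𝓑 →
      ((Captured q t B 𝓐 𝓑 ∩ (Supp q t).filter fun P => InteriorHalfDense ε δ P).card : ℝ) ≤
        (2 : ℝ) ^ (-((3 * q + 1 : ℝ) / 2 * Real.logb 2 (3 * q + 1)) - C * (3 * q + 1)) *
          ((Supp q t).filter fun P => InteriorHalfDense ε δ P).card

/-- **The card's reduction (typed, to be proved by counting):** star extremality + abundance of interior-half-dense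
rigid normal systems give the X1 clause for the conditioned uniform measure; with `NormalMostlyRigid`-type input and
`t ≥ 7` this is the normal-system line's assembly with (Q) ∧ (E) ∧ (½) replaced by ONE extremal statement and ONE
corrected density statement. -/
def StarReduction (t : ℕ) : Prop :=
  ∀ ε δ : ℝ, 0 < ε → 0 < δ → δ ≤ 1 / 4 → StarExtremality t → StrongAbundanceIHD t ε δ → UniformRectBound t ε δ

end targets

/-! ## 4. Seam covering: a SAT-free necessary condition for capture (card `seam-covering-cliques`)

For a normal system `P`, a ruler `k` and a vertex `v`, the SEAM COLOURING `seamCol (P k) v` (colour of `w` =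
`(pos_k w − pos_k v − 1) mod 3`) is a proper 3-colouring of every edge of `P` except the single cycle edge
`{v, succ_k v}` (normality handles the foreign edges, at every base point).  Consequently, if `{v, succ_k v}` lies
INSIDE `B` (so it is not one of Alice's edges) and a cell `aliceSide B P ∪ β'` of a valid rectangle is NOT
3-colourable, then `β'` must contain a `seamCol (P k) v`-monochromatic edge: Bob's graph COVERS that inside seam of
`P`.  So the captured set of every valid rectangle is a clique of the mutual-covering relation (`captured_covClique`),
and a bound on such cliques (`SeamCliqueBound`) implies the X1 clause for the conditioned uniform measure
(`uniformRectBound_of_seamCliqueBound`, PROVED).  The two-point law `seamCol_eq_iff` makes "covers" an explicit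
arc condition in `P`'s ruler coordinates — no 3-colourability left in the statement. -/

section covering

variable {q t : ℕ}

/-- position of the successor. -/
theorem pos_succ (P : Rulers q t) (k : Fin t) (v : Fin (3 * q + 1)) : P k (succ P k v) = P k v + 1 := by
  simp [succ]

/-- Along its own ruler, the seam colouring based at `v` is proper on every cycle edge `{u, succ_k u}` with `u ≠ v`. -/
theorem seamCol_succ_ne (P : Rulers q t) (k : Fin t) {v u : Fin (3 * q + 1)} (huv : u ≠ v) :
    seamCol (P k) v u ≠ seamCol (P k) v (succ P k u) := by
  intro h
  have hval : (P k u - P k v - 1).val % 3 = (P k (succ P k u) - P k v - 1).val % 3 := by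
    simpa [seamCol, Fin.ext_iff] using h
  have hc : P k (succ P k u) - P k v - 1 = (P k u - P k v - 1) + 1 := by rw [pos_succ]; ring
  rw [hc, Fin.val_add_one] at hval
  split_ifs at hval with hlast
  · -- `c = last` means `P k u = P k v`, i.e. `u = v`
    have h0 : (P k u - P k v - 1) + 1 = 0 := by rw [hlast]; exact Fin.last_add_one _
    have h1 : P k u - P k v = 0 := by rw [← h0]; ring
    exact huv ((P k).injective (sub_eq_zero.1 h1))
  · omega

/-- The seam colouring of ruler `k` is proper on every FOREIGN cycle edge `{u, succ_i u}`, `i ≠ k` (normality). -/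
theorem seamCol_foreign_ne {P : Rulers q t} (hN : IsNormal P) {i k : Fin t} (hik : i ≠ k)
    (v u : Fin (3 * q + 1)) : seamCol (P k) v u ≠ seamCol (P k) v (succ P i u) := by
  intro h
  have hval : (P k u - P k v - 1).val % 3 = (P k (succ P i u) - P k v - 1).val % 3 := by
    simpa [seamCol, Fin.ext_iff] using h
  have h2 := hN k i (Ne.symm hik) u
  have hdiff : P k (succ P i u) - P k u = (P k (succ P i u) - P k v - 1) - (P k u - P k v - 1) := by ring
  rw [hdiff] at h2
  generalize P k u - P k v - 1 = b at hval h2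
  generalize P k (succ P i u) - P k v - 1 = a at hval h2
  have hA := a.isLt
  have hB := b.isLt
  rcases val_sub_cases b a with ⟨h1, e1⟩ | ⟨h1, e1⟩ <;> rw [e1] at h2 <;> omega

/-- membership in the edge set of a system. -/
theorem mem_edges {P : Rulers q t} {e : Sym2 (Fin (3 * q + 1))} :
    e ∈ edges P ↔ ∃ i u, e = s(u, succ P i u) := by
  constructor
  · intro he
    simp only [edges, mem_biUnion, mem_univ, true_and, mem_image] at he
    obtain ⟨i, u, hu⟩ := he
    exact ⟨i, u, hu.symm⟩
  · rintro ⟨i, u, rfl⟩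
    simp only [edges, mem_biUnion, mem_univ, true_and, mem_image]
    exact ⟨i, u, rfl⟩

/-- `β'` COVERS the inside seams of `P` over `B`: for every cycle edge `{v, succ_k v}` of `P` inside `B`, Bob's graph
`β'` has an edge monochromatic under the seam colouring of ruler `k` based at `v` (an explicit arc condition by
`seamCol_eq_iff`). -/
def Covers (B : Finset (Fin (3 * q + 1))) (β' : Finset (Sym2 (Fin (3 * q + 1)))) (P : Rulers q t) : Prop :=
  ∀ (k : Fin t) (v : Fin (3 * q + 1)), v ∈ B → succ P k v ∈ B →
    ∃ x y, s(x, y) ∈ β' ∧ x ≠ y ∧ seamCol (P k) v x = seamCol (P k) v y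

/-- **Seam covering (PROVED).**  In a valid rectangle, if Alice's side of the normal system `P` is filed and `β'` is
any filed Bob graph, then `β'` covers every inside seam of `P` — otherwise the seam colouring 3-colours the cell. -/
theorem covers_of_validRect {P : Rulers q t} (hN : IsNormal P) {B : Finset (Fin (3 * q + 1))}
    {𝓐 𝓑 : Finset (Finset (Sym2 (Fin (3 * q + 1))))} (hV : ValidRect B 𝓐 𝓑)
    (hα : aliceSide B (edges P) ∈ 𝓐) {β' : Finset (Sym2 (Fin (3 * q + 1)))} (hβ : β' ∈ 𝓑) :
    Covers B β' P := by
  intro k v hv hsv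
  by_contra hcov
  push Not at hcov
  apply hV.2.2 _ hα _ hβ
  refine ⟨SimpleGraph.Coloring.mk (fun w => seamCol (P k) v w) ?_⟩
  intro x y hadj
  rw [SimpleGraph.fromEdgeSet_adj] at hadj
  obtain ⟨hmem, hxy⟩ := hadj
  have hmem' : s(x, y) ∈ aliceSide B (edges P) ∪ β' := hmem
  rcases mem_union.1 hmem' with h | h
  · obtain ⟨he, w, hw, hwB⟩ := mem_aliceSide.1 h
    obtain ⟨i, u, hiu⟩ := mem_edges.1 he
    -- the edge `{u, succ_i u}` is properly coloured unless it is the seam itself, which lies inside `B`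
    have hne : seamCol (P k) v u ≠ seamCol (P k) v (succ P i u) := by
      by_cases hik : i = k
      · subst hik
        refine seamCol_succ_ne P i ?_
        rintro rfl
        rw [hiu] at hw
        rcases Sym2.mem_iff.1 hw with rfl | rfl
        · exact hwB hv
        · exact hwB hsv
      · exact seamCol_foreign_ne hN hik v u
    rcases Sym2.eq_iff.1 hiu with ⟨rfl, rfl⟩ | ⟨rfl, rfl⟩
    · exact hne
    · exact fun h' => hne h'.symm
  · exact hcov x y h hxy

/-- a COV-CLIQUE over `B`: a family of systems each of whose Bob graphs covers every member's inside seams. -/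
def CovClique (B : Finset (Fin (3 * q + 1))) (K : Finset (Rulers q t)) : Prop :=
  ∀ P ∈ K, ∀ P' ∈ K, Covers B (bobSide B (edges P')) P

/-- sub-families of COV-cliques are COV-cliques. -/
theorem CovClique.mono {B : Finset (Fin (3 * q + 1))} {K K' : Finset (Rulers q t)} (h : CovClique B K)
    (hK : K' ⊆ K) : CovClique B K' :=
  fun P hP P' hP' => h P (hK hP) P' (hK hP')

open Classical in
/-- **Captured sets are COV-cliques (PROVED).**  Every valid cut rectangle captures a COV-clique of the support. -/
theorem captured_covClique (B : Finset (Fin (3 * q + 1))) {𝓐 𝓑 : Finset (Finset (Sym2 (Fin (3 * q + 1))))}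
    (hV : ValidRect B 𝓐 𝓑) : CovClique B (Captured q t B 𝓐 𝓑) := by
  intro P hP P' hP'
  simp only [Captured, Supp, mem_filter, mem_univ, true_and] at hP hP'
  exact covers_of_validRect hP.1.1 hV hP.2.1 hP'.2.2

open Classical in
/-- **(Q_seam) — the SAT-free residual crux of the normal-system line.**  Within the interior-half-dense support,
every COV-clique over a near-balanced cut has relative size `≤ 2^{-(n/2)·log₂ n − C·n}`, eventually, for each `C`. -/
noncomputable def SeamCliqueBound (t : ℕ) (ε δ : ℝ) : Prop :=
  ∀ C : ℕ, ∃ q₀ : ℕ, ∀ q ≥ q₀, ∀ (B : Finset (Fin (3 * q + 1))) (K : Finset (Rulers q t)),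
    (1 / 2 - δ) * (3 * q + 1 : ℝ) ≤ B.card → (B.card : ℝ) ≤ (1 / 2 + δ) * (3 * q + 1 : ℝ) →
      K ⊆ (Supp q t).filter (fun P => InteriorHalfDense ε δ P) → CovClique B K →
        (K.card : ℝ) ≤ (2 : ℝ) ^ (-((3 * q + 1 : ℝ) / 2 * Real.logb 2 (3 * q + 1)) - C * (3 * q + 1)) *
          ((Supp q t).filter fun P => InteriorHalfDense ε δ P).card

open Classical in
/-- **Reduction (PROVED):** the COV-clique bound implies the X1 rectangle clause for the conditioned uniform
measure `μ_t` (every captured set is a COV-clique, `captured_covClique`). -/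
theorem uniformRectBound_of_seamCliqueBound {t : ℕ} {ε δ : ℝ} (h : SeamCliqueBound t ε δ) :
    UniformRectBound t ε δ := by
  intro C
  obtain ⟨q₀, hq₀⟩ := h C
  refine ⟨q₀, fun q hq B 𝓐 𝓑 h1 h2 hV => ?_⟩
  exact hq₀ q hq B _ h1 h2 inter_subset_right ((captured_covClique B hV).mono inter_subset_left)

end covering

end Summit.PneNP.PneNP.Cruxes.FoolingMeasure.IdeasR2g5s2
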